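import Summits.MatrixMultiplication.MatrixMultiplication.Theorems.ObstructionDescentKroneckerRankMethods
import Literature.Barriers.MatrixMultiplication.LinearRankMethodBarrierProofs

/-!
# The cactus wall is Kronecker-stable: fine-normalised Kronecker-power rank methods are blind on
# `GL_m³·pad_m⟨n,n,n⟩` past `m ≥ 6n² − 4`, for every power `k`
(decomp-mm · lens 3 · gen 21; method axis of `E = NoPolyDegreeObstruction`, rung R2^{⊠,fine})

Route `route-MatrixMultiplication-ObstructionDescent` (`ω(ℂ) = 2`).  A **Kronecker-power rank method of degree
`k`** is a linear map `Λ` on the `k`-th Kronecker-power format `((ℂ^m)^{⊗k})^{⊗3}` (index type `Fin k → Fin m` in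
each of the three slots), applied to `T^{⊠k}`; it is FINELY normalised by
`ρ = max rk Λ((w₁⊗⋯⊗w_k) ⊗ (u₁⊗⋯⊗u_k) ⊗ (v₁⊗⋯⊗v_k))` over the `3k`-fold (fine) rank-one tensors — the
Kronecker products of `k` triads `wₛ ⊗ uₛ ⊗ vₛ` — and certifies `bR(T) > r` as soon as `rk Λ(T^{⊠k}) > ρ·r^k`
(`T ∈ σ_r ⇒ T^{⊠k}` is a limit of sums of `r^k` fine rank-one tensors).  Every homogeneous degree-`k` polynomial
matrix map `T ↦ M(T)` is such a `Λ(T^{⊠k})`; the class contains the Kronecker powers of all flattenings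
(Strassen's commutator, Koszul–Young flattenings; Conner–Gesmundo–Landsberg–Ventura 2022 §3 use exactly these on
`T^{⊠2}, T^{⊠3}`), and its threshold `ρ·r^k` is the one the Kronecker–Koszul equations of Doležálek–Michałek 2026
improve by the lower-order factor `χ_G(r)/r^k` (their Thm. 3.3 / Cor. 3.5) to go beyond cactus at MINIMAL border rank.

* `rank_apply_kroneckerPow_le_pow` — **the Kronecker-stable cactus bound**: for ALL `A, B, C ∈ Mat_m` and every
  `k`, `rk Λ(((A,B,C)·pad_m⟨n,n,n⟩)^{⊠k}) ≤ ρ·(6n² − 4)^k` (`n ≥ 1`).  Proof by induction on `k`, peeling one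
  Kronecker factor: with `S = (A,B,C)·pad_m⟨n,n,n⟩` and `S^{⊠(k+1)} ≅ S ⊠ S^{⊠k}` (`consIdx`), the map
  `y ↦ Λ(y ⊠ S^{⊠k})` is a LINEAR rank method on `ℂ^{m³}` whose value on a triad `w₀⊗u₀⊗v₀` is the value at
  `S^{⊠k}` of the degree-`k` method `x ↦ Λ((w₀⊗u₀⊗v₀) ⊠ x)` — finely normalised by the same `ρ`, so of rank
  `≤ ρ(6n²−4)^k` by induction — and rung R2's cactus bound on the pad
  (`ObstructionDescentRankMethodsBlind.rank_apply_actTensor_padMM_le`, from the tree THEOREM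
  `Literature.Barriers.MatrixMultiplication.Buczynski2026_cactusBarrier_segre_holds`) multiplies by one more
  `6n² − 4`.  Equivalently: the certificate such a method gives for `bR` of any restriction of `⟨n,n,n⟩` is
  `(rk/ρ)^{1/k} ≤ 6n² − 4` — the SAME cactus wall as for `k = 1`; Kronecker powers do not lift rank methods over it.
* `fineKroneckerRankMethodsBlind` — **rung R2^{⊠,fine}** (the route's aside `FineKroneckerRankMethodsBlind`, gen 21):
  past the wall `6n² − 4 ≤ m` (that of item 30921, independent of `k`) the bound is `≤ ρ·m^k`, the maximum the
  method takes on `{T^{⊠k} : T ∈ σ_m}`: no finely-normalised Kronecker-power rank method of any degree separates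
  `GL_m³·pad_m⟨n,n,n⟩` from `σ_m` there — in particular in every cell `m ≥ n^τ, τ > 2` of `E`.  The pad is spelled
  inline exactly as in the route file.  `k = 1` is item 30921; the coarsely-normalised class (aside 27417
  `KroneckerRankMethodsBlind`, whose hypothesis bounds `Λ` on ALL triads `W ⊗ U ⊗ V` of the power format) is the
  sub-case `ρ_coarse ≥ ρ`, there with the lower wall `6n^{2k} − 4 ≤ m^k`.
* `fineKroneckerRankMethodsBlind_holds : FineKroneckerRankMethodsBlind` — the item, by the above.

Scope (honest): the Doležálek–Michałek threshold `χ_G(r)·ρ < r^k·ρ` is NOT the fine threshold; for their shapes the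
bound here gives blindness on the MM corner once `χ_G(m) ≥ (6n²−4)^k`, i.e. `m ≥ 6n² + k − 5` (since
`χ_G(m) ≥ (m−k+1)^k`) — still linear in `n²`, far below the cells of `E`; the OPTIMALLY normalised class
(threshold `max_{σ_m} rk M`) is all of `E` by Valiant universality and is not claimed.  One definition (`consIdx`,
a reindexing); sorry-free; standard axioms.
[cite: Buczynski2026, Thm. 2 / Cor. 13 / §1.5–1.6; DolezalekMichalek2026, §3 (Thm. 3.3, Cor. 3.5) and §5.1;
ConnerGesmundoLandsbergVentura2022, §3 (Prop. 3.2); GargMakamOliveiraWigderson2019, §1.4; LandsbergGCT2017, §10.2.2;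
BurgisserIkenmeyer2011, §2 and §5]
-/

set_option linter.dupNamespace false
set_option autoImplicit false

noncomputable section

open scoped BigOperators

namespace Summit.MatrixMultiplication.MatrixMultiplication.Theorems.ObstructionDescentKroneckerStable

open Literature.Computability.AlgebraicComplexity (actTensor matMulTensor triad triad_apply actTensor_zero
  kroneckerPow kroneckerPow_apply kroneckerTensor kroneckerTensor_apply)
open Summit.MatrixMultiplication.MatrixMultiplication.Theorems.ObstructionCalculus (Tensor padMM)
open Summit.MatrixMultiplication.MatrixMultiplication.Theorems.ObstructionDescentRankMethodsBlind
  (rank_apply_actTensor_padMM_le padMM_zero)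
open Summit.MatrixMultiplication.MatrixMultiplication.Theorems.ObstructionDescentKroneckerRankMethods (kroneckerPow_zero_tensor)

/-! ## §1 Peeling one Kronecker factor -/

/-- Reindexing a tensor on the product format `(ℂ^m ⊗ (ℂ^m)^{⊗k})^{⊗3}` (index `Fin m × (Fin k → Fin m)`) to the
`(k+1)`-st power format (index `Fin (k+1) → Fin m`): head and tail. [bookkeeping] -/
def consIdx {m k : ℕ}
    (u : (Fin m × (Fin k → Fin m)) → (Fin m × (Fin k → Fin m)) → (Fin m × (Fin k → Fin m)) → ℂ) :
    (Fin (k + 1) → Fin m) → (Fin (k + 1) → Fin m) → (Fin (k + 1) → Fin m) → ℂ :=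
  fun a b c => u (a 0, Fin.tail a) (b 0, Fin.tail b) (c 0, Fin.tail c)

/-- `consIdx` is additive. [bookkeeping] -/
theorem consIdx_add {m k : ℕ}
    (u u' : (Fin m × (Fin k → Fin m)) → (Fin m × (Fin k → Fin m)) → (Fin m × (Fin k → Fin m)) → ℂ) :
    consIdx (u + u') = consIdx u + consIdx u' := rfl

/-- `consIdx` commutes with scalars. [bookkeeping] -/
theorem consIdx_smul {m k : ℕ} (z : ℂ)
    (u : (Fin m × (Fin k → Fin m)) → (Fin m × (Fin k → Fin m)) → (Fin m × (Fin k → Fin m)) → ℂ) :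
    consIdx (z • u) = z • consIdx u := rfl

/-- `S^{⊠(k+1)} ≅ S ⊠ S^{⊠k}`. [folklore] -/
theorem consIdx_kroneckerTensor_kroneckerPow {m k : ℕ} (S : Tensor ℂ m) :
    consIdx (kroneckerTensor S (kroneckerPow S k)) = kroneckerPow S (k + 1) := by
  funext a b c
  simp only [consIdx, kroneckerTensor_apply, kroneckerPow_apply]
  rw [Fin.prod_univ_succ]
  rfl

/-- A triad Kroneckered onto a fine rank-one tensor `⊠ₛ (wₛ⊗uₛ⊗vₛ)` is the fine rank-one tensor of the
`cons`-families. [folklore] -/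
theorem consIdx_kroneckerTensor_triad {m k : ℕ} (w₀ u₀ v₀ : Fin m → ℂ) (w u v : Fin k → Fin m → ℂ) :
    consIdx (kroneckerTensor (triad w₀ u₀ v₀)
        (fun a b c => ∏ s, triad (w s) (u s) (v s) (a s) (b s) (c s))) =
      fun a b c => ∏ s, triad ((Fin.cons w₀ w : Fin (k + 1) → Fin m → ℂ) s)
        ((Fin.cons u₀ u : Fin (k + 1) → Fin m → ℂ) s) ((Fin.cons v₀ v : Fin (k + 1) → Fin m → ℂ) s)
        (a s) (b s) (c s) := by
  funext a b c
  simp only [consIdx, kroneckerTensor_apply]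
  rw [Fin.prod_univ_succ]
  simp only [Fin.cons_zero, Fin.cons_succ]
  rfl

/-- `(y + y') ⊠ x = y ⊠ x + y' ⊠ x`. [folklore] -/
theorem kroneckerTensor_add_left {ι κ μ ι' κ' μ' : Type} (y y' : ι → κ → μ → ℂ) (x : ι' → κ' → μ' → ℂ) :
    kroneckerTensor (y + y') x = kroneckerTensor y x + kroneckerTensor y' x := by
  funext a b c
  simp only [kroneckerTensor_apply, Pi.add_apply, add_mul]

/-- `(z y) ⊠ x = z (y ⊠ x)`. [folklore] -/
theorem kroneckerTensor_smul_left {ι κ μ ι' κ' μ' : Type} (z : ℂ) (y : ι → κ → μ → ℂ) (x : ι' → κ' → μ' → ℂ) :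
    kroneckerTensor (z • y) x = z • kroneckerTensor y x := by
  funext a b c
  simp only [kroneckerTensor_apply, Pi.smul_apply, smul_eq_mul, mul_assoc]

/-- `y ⊠ (x + x') = y ⊠ x + y ⊠ x'`. [folklore] -/
theorem kroneckerTensor_add_right {ι κ μ ι' κ' μ' : Type} (y : ι → κ → μ → ℂ) (x x' : ι' → κ' → μ' → ℂ) :
    kroneckerTensor y (x + x') = kroneckerTensor y x + kroneckerTensor y x' := by
  funext a b c
  simp only [kroneckerTensor_apply, Pi.add_apply, mul_add]

/-- `y ⊠ (z x) = z (y ⊠ x)`. [folklore] -/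
theorem kroneckerTensor_smul_right {ι κ μ ι' κ' μ' : Type} (z : ℂ) (y : ι → κ → μ → ℂ) (x : ι' → κ' → μ' → ℂ) :
    kroneckerTensor y (z • x) = z • kroneckerTensor y x := by
  funext a b c
  simp only [kroneckerTensor_apply, Pi.smul_apply, smul_eq_mul]
  ring

/-! ## §2 The Kronecker-stable cactus bound -/

/-- **The cactus wall is Kronecker-stable**: for `n ≥ 1`, all `A, B, C ∈ Mat_m`, every `k` and every linear `Λ`
on `((ℂ^m)^{⊗k})^{⊗3}` with `rk Λ ≤ ρ` on the fine rank-one tensors `⊠ₛ (wₛ⊗uₛ⊗vₛ)`,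
`rk Λ(((A,B,C)·pad_m⟨n,n,n⟩)^{⊠k}) ≤ ρ·(6n² − 4)^k`.  Induction on `k`, peeling one Kronecker factor and
applying rung R2's cactus bound on the pad to the linear rank method `y ↦ Λ(y ⊠ S^{⊠k})`.
[cite: Buczynski2026, Thm. 2 / Cor. 13; ConnerGesmundoLandsbergVentura2022, §3; LandsbergGCT2017, §10.2.2] -/
theorem rank_apply_kroneckerPow_le_pow {n m : ℕ} (hn : 1 ≤ n) (h : n * n ≤ m) (A B C : Matrix (Fin m) (Fin m) ℂ)
    {p q : ℕ} : ∀ (k ρ : ℕ)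
      (Λ : ((Fin k → Fin m) → (Fin k → Fin m) → (Fin k → Fin m) → ℂ) →ₗ[ℂ] Matrix (Fin p) (Fin q) ℂ),
      (∀ w u v : Fin k → Fin m → ℂ, (Λ (fun a b c => ∏ s, triad (w s) (u s) (v s) (a s) (b s) (c s))).rank ≤ ρ) →
        (Λ (kroneckerPow (actTensor A B C (padMM ℂ n m h)) k)).rank ≤ ρ * (6 * n ^ 2 - 4) ^ k := by
  intro k
  induction k with
  | zero =>
    intro ρ Λ hρ
    have e : kroneckerPow (actTensor A B C (padMM ℂ n m h)) 0 =
        fun a b c => ∏ s, triad ((fun _ _ => (0 : ℂ)) s) ((fun _ _ => (0 : ℂ)) s) ((fun _ _ => (0 : ℂ)) s)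
          (a s) (b s) (c s) := by
      funext a b c
      simp [kroneckerPow_apply]
    rw [e, pow_zero, mul_one]
    exact hρ (fun _ _ => 0) (fun _ _ => 0) (fun _ _ => 0)
  | succ k ih =>
    intro ρ Λ hρ
    set S : Tensor ℂ m := actTensor A B C (padMM ℂ n m h) with hS
    -- `Λ` on the product format, via the `cons` reindexing
    let Λ' : ((Fin m × (Fin k → Fin m)) → (Fin m × (Fin k → Fin m)) → (Fin m × (Fin k → Fin m)) → ℂ) →ₗ[ℂ]
        Matrix (Fin p) (Fin q) ℂ :=
      Λ ∘ₗ { toFun := consIdx, map_add' := consIdx_add, map_smul' := consIdx_smul }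
    -- step A: the linear rank method `y ↦ Λ(y ⊠ S^{⊠k})` on `ℂ^{m³}`
    let LA : Tensor ℂ m →ₗ[ℂ] Matrix (Fin p) (Fin q) ℂ :=
      { toFun := fun y => Λ' (kroneckerTensor y (kroneckerPow S k))
        map_add' := fun y y' => by simp only [kroneckerTensor_add_left, map_add]
        map_smul' := fun z y => by simp only [kroneckerTensor_smul_left, map_smul, RingHom.id_apply] }
    -- its rank-one bound, by the induction hypothesis applied to `x ↦ Λ((w₀⊗u₀⊗v₀) ⊠ x)`
    have hA : ∀ w₀ u₀ v₀ : Fin m → ℂ, (LA (triad w₀ u₀ v₀)).rank ≤ ρ * (6 * n ^ 2 - 4) ^ k := by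
      intro w₀ u₀ v₀
      let LB : ((Fin k → Fin m) → (Fin k → Fin m) → (Fin k → Fin m) → ℂ) →ₗ[ℂ] Matrix (Fin p) (Fin q) ℂ :=
        { toFun := fun x => Λ' (kroneckerTensor (triad w₀ u₀ v₀) x)
          map_add' := fun x x' => by simp only [kroneckerTensor_add_right, map_add]
          map_smul' := fun z x => by simp only [kroneckerTensor_smul_right, map_smul, RingHom.id_apply] }
      have hB : ∀ w u v : Fin k → Fin m → ℂ,
          (LB (fun a b c => ∏ s, triad (w s) (u s) (v s) (a s) (b s) (c s))).rank ≤ ρ := by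
        intro w u v
        change (Λ (consIdx (kroneckerTensor (triad w₀ u₀ v₀)
          (fun a b c => ∏ s, triad (w s) (u s) (v s) (a s) (b s) (c s))))).rank ≤ ρ
        rw [consIdx_kroneckerTensor_triad]
        exact hρ _ _ _
      exact ih ρ LB hB
    -- step B: rung R2's cactus bound on the pad for `LA`
    have key := rank_apply_actTensor_padMM_le
      (fun a b c ha hb hc hι hκ hμ p q L k hk t =>
        Literature.Barriers.MatrixMultiplication.Buczynski2026_cactusBarrier_segre_holds a b c ha hb hc hι hκ hμ
          p q L k hk t) hn h LA hA A B C
    have e : LA (actTensor A B C (padMM ℂ n m h)) = Λ (kroneckerPow S (k + 1)) := by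
      change Λ (consIdx (kroneckerTensor S (kroneckerPow S k))) = _
      rw [consIdx_kroneckerTensor_kroneckerPow]
    rw [e] at key
    rw [pow_succ, ← mul_assoc]
    exact key

/-! ## §3 Rung R2^{⊠,fine}: the item -/

/-- **Rung R2^{⊠,fine} (the route's aside `FineKroneckerRankMethodsBlind`, gen 21)**: past the cactus wall
`6n² − 4 ≤ m` — the wall of item 30921, the same for every `k` — every linear `Λ` on `((ℂ^m)^{⊗k})^{⊗3}` with
`rk Λ ≤ ρ` on the fine rank-one tensors `⊠ₛ (wₛ⊗uₛ⊗vₛ)` has `rk Λ(((A,B,C)·pad_m⟨n,n,n⟩)^{⊠k}) ≤ ρ·m^k` for ALL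
`A, B, C ∈ Mat_m`, the maximum it takes on `{T^{⊠k} : T ∈ σ_m}`; so no `σ_m`-equation of the fine Kronecker-power
determinantal class (a `(ρm^k+1)`-minor of `T ↦ Λ(T^{⊠k})`, any `k`, any `Λ`; every homogeneous degree-`k`
polynomial matrix map with the `σ_{m}^{⊠k}`-threshold) separates the `GL_m³`-orbit of the pad from `σ_m`.  The
pad is spelled inline exactly as in the route file (`= padMM ℂ n m h` by `rfl`).
[cite: Buczynski2026, Thm. 2 / Cor. 13 / §1.5–1.6; DolezalekMichalek2026, §3; ConnerGesmundoLandsbergVentura2022, §3] -/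
theorem fineKroneckerRankMethodsBlind :
    ∀ (k n m : ℕ) (h : n * n ≤ m), 6 * n ^ 2 - 4 ≤ m →
      ∀ (p q ρ : ℕ) (L : ((Fin k → Fin m) → (Fin k → Fin m) → (Fin k → Fin m) → ℂ) →ₗ[ℂ] Matrix (Fin p) (Fin q) ℂ),
        (∀ w u v : Fin k → Fin m → ℂ, (L (fun a b c => ∏ s,
            Literature.Computability.AlgebraicComplexity.triad (w s) (u s) (v s) (a s) (b s) (c s))).rank ≤ ρ) →
          ∀ A B C : Matrix (Fin m) (Fin m) ℂ,
            (L (Literature.Computability.AlgebraicComplexity.kroneckerPow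
              (Literature.Computability.AlgebraicComplexity.actTensor A B C (fun a b c : Fin m =>
                ∑ r : (Fin n × Fin n) × (Fin n × Fin n) × (Fin n × Fin n),
                  (if Fin.castLE h (finProdFinEquiv r.1) = a ∧ Fin.castLE h (finProdFinEquiv r.2.1) = b ∧
                      Fin.castLE h (finProdFinEquiv r.2.2) = c then (1 : ℂ) else 0) *
                    Literature.Computability.AlgebraicComplexity.matMulTensor ℂ n n n r.1 r.2.1 r.2.2)) k)).rank ≤
              ρ * m ^ k := by
  intro k n m h hm p q ρ L hρ A B C
  change (L (kroneckerPow (actTensor A B C (padMM ℂ n m h)) k)).rank ≤ ρ * m ^ k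
  rcases Nat.eq_zero_or_pos n with rfl | hn
  · -- `n = 0`: the pad is the zero tensor
    rcases Nat.eq_zero_or_pos k with rfl | hk
    · have e : kroneckerPow (actTensor A B C (padMM ℂ 0 m h)) 0 =
          fun a b c => ∏ s, triad ((fun _ _ => (0 : ℂ)) s) ((fun _ _ => (0 : ℂ)) s) ((fun _ _ => (0 : ℂ)) s)
            (a s) (b s) (c s) := by
        funext a b c
        simp [kroneckerPow_apply]
      rw [e, pow_zero, mul_one]
      exact hρ (fun _ _ => 0) (fun _ _ => 0) (fun _ _ => 0)
    · rw [padMM_zero, actTensor_zero, kroneckerPow_zero_tensor k hk, map_zero, Matrix.rank_zero]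
      exact Nat.zero_le _
  · exact (rank_apply_kroneckerPow_le_pow hn h A B C k ρ L hρ).trans
      (Nat.mul_le_mul_left ρ (Nat.pow_le_pow_left hm k))

/-- **The item `FineKroneckerRankMethodsBlind` holds** (the route decl; its text is `fineKroneckerRankMethodsBlind`
verbatim). [cite: Buczynski2026, Thm. 2 / Cor. 13 / §1.5–1.6] -/
theorem fineKroneckerRankMethodsBlind_holds :
    Summit.MatrixMultiplication.MatrixMultiplication.Theses.ObstructionDescent.FineKroneckerRankMethodsBlind :=
  fineKroneckerRankMethodsBlind

/-- **Coarse from fine** (sanity: aside 27417's hypothesis — `rk ≤ ρ` on ALL triads `W ⊗ U ⊗ V` of the power format —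
implies the fine one, since `⊠ₛ (wₛ⊗uₛ⊗vₛ) = (⊗wₛ) ⊗ (⊗uₛ) ⊗ (⊗vₛ)`); so past `m ≥ 6n² − 4` the coarse class is blind
too (aside 27417 itself uses the lower wall `6n^{2k} − 4 ≤ m^k`). [bookkeeping] -/
theorem fine_hyp_of_coarse_hyp {k m p q ρ : ℕ}
    (L : ((Fin k → Fin m) → (Fin k → Fin m) → (Fin k → Fin m) → ℂ) →ₗ[ℂ] Matrix (Fin p) (Fin q) ℂ)
    (hρ : ∀ W U V : (Fin k → Fin m) → ℂ, (L (triad W U V)).rank ≤ ρ) (w u v : Fin k → Fin m → ℂ) :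
    (L (fun a b c => ∏ s, triad (w s) (u s) (v s) (a s) (b s) (c s))).rank ≤ ρ := by
  have e : (fun a b c : Fin k → Fin m => ∏ s, triad (w s) (u s) (v s) (a s) (b s) (c s)) =
      triad (fun a => ∏ s, w s (a s)) (fun b => ∏ s, u s (b s)) (fun c => ∏ s, v s (c s)) := by
    funext a b c
    simp only [triad_apply, Finset.prod_mul_distrib]
  rw [e]
  exact hρ _ _ _

end Summit.MatrixMultiplication.MatrixMultiplication.Theorems.ObstructionDescentKroneckerStable

end
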